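import Summits.HodgeConjecture.HodgeConjecture.Theorems.HodgeLocusCensusTwoBlockCerts
import HarnessLib

/-!
# HodgeLocusCensusDenseStack8 — dense kernel-checkable certificates for the STACKED rank [M_δ₁ ; M_δ₂] on the Fermat cubic 8-fold (cell pub-hlocus, LEAD seat ivhs-1, gen 6, (T42))
HONEST FRAMING: certified instances and evidence bearing on the general Hodge conjecture; no claim.

`HodgeLocusCensusDenseCert8` (engine-B seat) certifies the rank of ONE Movasati matrix M_δ = [p_{i+j}(δ)] (45 × 120, rows I₂, columns I₃) for an
arbitrary signed sum δ of linear cycles of X³₈. The first-order EXCESS of a pair of cycles needs a second number: the rank of the STACKED matrix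
[M_δ₁ ; M_δ₂] (90 × 120), whose kernel is the intersection of the two Zariski tangent spaces T NL(δ₁) ∩ T NL(δ₂) at the Fermat point — for two
linear cycles P, P′ this is Movasati's `intdim` [cite: Movasati2016Periods, §6 Thm. 13] computed rather than quoted. This module is the stacked
variant of the dense format, re-using its data types verbatim:
* `entryS L₁ L₂ a b` = the (a, b) entry of the stacked integer table (rows a < 45 from the class list L₁, rows 45 ≤ a < 90 from L₂);
* for a `DenseCert` Ψ (same structure: r, pivot rows ρ (now < 90) and columns γ, the 90 × r row-expression table W, the triangular factors A, B
  of the pivot minor and the norm cofactors w) the Boolean `Ψ.validS L₁ L₂` = (U) Σ_ℓ W[a,ℓ]·S[ρ_ℓ,b] = S[a,b] on 90 × 120, (L) A·B = S[ρ,γ],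
  (T) triangularity (the single-matrix `validT`), (P) positive-integer pivots and index ranges;
* soundness `stackRank_of_cert`: class links `periodComb 8 3 ζ δ_i = eval_ζ ∘ entry L_i ∘ ext` (i = 1, 2) and `Ψ.validS L₁ L₂ = true` give
  rank (fromRows M_δ₁ M_δ₂) = r over every characteristic-0 field with a primitive 6th root of unity ζ (reindexing `eRowS : Fin (45+45) ≃ I₂ ⊕ I₂`
  through `finSumFinEquiv` and the single-matrix `eRow`, `eCol`; upper bound S = W·S[ρ,·]; lower bound: the pivot minor is lower × upper triangular
  with nonzero diagonal, exactly as in the single-matrix file).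
Data files: `HodgeLocusCensusCubicCertStack{Two,Std}`; rows: `HodgeLocusCensusCubicStackedRows`. Generator t42/gen83s.py (exact ℚ(ζ₆); every identity
re-multiplied before emission; the kernel re-multiplies again).
-/

namespace Summit.HodgeConjecture.HodgeConjecture.HodgeLocus.Census.DenseCert8

open PlaneSum CubicSum

/-! ## Stacked entries and the stacked validity predicate -/

/-- the (a, b) entry of the stacked table [S(L₁) ; S(L₂)]: rows a < 45 are the rows of the class L₁, rows 45 ≤ a (< 90) those of L₂. -/
def entryS (L1 L2 : List PDat) (a b : ℕ) : Z6 := if a < 45 then entry L1 (vab a b) else entry L2 (vab (a - 45) b)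

namespace DenseCert

variable (Ψ : DenseCert)

/-- the ℓ-th term of row a's expression in the pivot rows of the STACKED table (zero coefficients short-circuit). -/
def utermS (L1 L2 : List PDat) (a b l : ℕ) : Z6 :=
  if zIsZero (Ψ.Wz a l) = true then 0 else Ψ.Wz a l * entryS L1 L2 (Ψ.rhoN l) b

/-- (U, stacked) every one of the 90 rows is the tabulated combination of the pivot rows: Σ_ℓ W[a,ℓ] S[ρ_ℓ, b] = S[a, b]. -/
def validUS (L1 L2 : List PDat) : Bool :=
  Z8.allLT 90 fun a => Z8.allLT 120 fun b => decide (Z6.rsum Ψ.r (Ψ.utermS L1 L2 a b) = entryS L1 L2 a b)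
/-- (L, stacked) the factors re-multiply to the pivot minor: Σ_ℓ A[h,ℓ] B[ℓ,g] = S[ρ_h, γ_g]. -/
def validLS (L1 L2 : List PDat) : Bool :=
  Z8.allLT Ψ.r fun h => Z8.allLT Ψ.r fun g => decide (Z6.rsum Ψ.r (fun l => Ψ.Az h l * Ψ.Bz l g) = entryS L1 L2 (Ψ.rhoN h) (Ψ.gamN g))
/-- (P, stacked) pivots: A_ℓℓ a positive integer, B_ℓℓ · w_ℓ a positive integer, ρ_ℓ < 90 and γ_ℓ < 120. -/
def validPS : Bool :=
  Z8.allLT Ψ.r fun l => (Ψ.Az l l).isPosConst && (Ψ.Bz l l * Ψ.wz l).isPosConst && decide (Ψ.rhoN l < 90) && decide (Ψ.gamN l < 120)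
/-- the whole stacked certificate check ((T) is the single-matrix triangularity test). -/
def validS (L1 L2 : List PDat) : Bool := Ψ.validUS L1 L2 && Ψ.validLS L1 L2 && Ψ.validT && Ψ.validPS

variable {Ψ} {L1 L2 : List PDat}

/-- (U, stacked) unfolded. -/
theorem US_eq (h : Ψ.validS L1 L2 = true) {a b : ℕ} (ha : a < 90) (hb : b < 120) :
    Z6.rsum Ψ.r (Ψ.utermS L1 L2 a b) = entryS L1 L2 a b := by
  have h1 : Ψ.validUS L1 L2 = true := by
    simp only [validS, Bool.and_eq_true] at h
    exact h.1.1.1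
  unfold validUS at h1
  rw [Z8.allLT_iff] at h1
  have h2 := h1 a ha
  rw [Z8.allLT_iff] at h2
  exact of_decide_eq_true (h2 b hb)

/-- (L, stacked) unfolded. -/
theorem LS_eq (h : Ψ.validS L1 L2 = true) {h' g : ℕ} (hh : h' < Ψ.r) (hg : g < Ψ.r) :
    Z6.rsum Ψ.r (fun l => Ψ.Az h' l * Ψ.Bz l g) = entryS L1 L2 (Ψ.rhoN h') (Ψ.gamN g) := by
  have h1 : Ψ.validLS L1 L2 = true := by
    simp only [validS, Bool.and_eq_true] at h
    exact h.1.1.2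
  unfold validLS at h1
  rw [Z8.allLT_iff] at h1
  have h2 := h1 h' hh
  rw [Z8.allLT_iff] at h2
  exact of_decide_eq_true (h2 g hg)

/-- (T) from the stacked check: A above the diagonal vanishes … -/
theorem AS_upper_zero (h : Ψ.validS L1 L2 = true) {h' l : ℕ} (hh : h' < Ψ.r) (hl : l < Ψ.r) (hlt : h' < l) : Ψ.Az h' l = 0 := by
  have h1 : Ψ.validT = true := by
    simp only [validS, Bool.and_eq_true] at h
    exact h.1.2
  unfold validT at h1
  rw [Z8.allLT_iff] at h1
  have h2 := h1 h' hh
  rw [Z8.allLT_iff] at h2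
  have h3 := h2 l hl
  simp only [Bool.and_eq_true, Bool.or_eq_true, Bool.not_eq_true', decide_eq_false_iff_not] at h3
  rcases h3.1 with h4 | h4
  · exact absurd hlt h4
  · exact eq_zero_of_zIsZero h4

/-- … and B below the diagonal. -/
theorem BS_lower_zero (h : Ψ.validS L1 L2 = true) {h' l : ℕ} (hh : h' < Ψ.r) (hl : l < Ψ.r) (hlt : l < h') : Ψ.Bz h' l = 0 := by
  have h1 : Ψ.validT = true := by
    simp only [validS, Bool.and_eq_true] at h
    exact h.1.2
  unfold validT at h1
  rw [Z8.allLT_iff] at h1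
  have h2 := h1 h' hh
  rw [Z8.allLT_iff] at h2
  have h3 := h2 l hl
  simp only [Bool.and_eq_true, Bool.or_eq_true, Bool.not_eq_true', decide_eq_false_iff_not] at h3
  rcases h3.2 with h4 | h4
  · exact absurd hlt h4
  · exact eq_zero_of_zIsZero h4

/-- (P, stacked) unfolded. -/
theorem pivotsS (h : Ψ.validS L1 L2 = true) {l : ℕ} (hl : l < Ψ.r) :
    (Ψ.Az l l).isPosConst = true ∧ (Ψ.Bz l l * Ψ.wz l).isPosConst = true ∧ Ψ.rhoN l < 90 ∧ Ψ.gamN l < 120 := by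
  have h1 : Ψ.validPS = true := by
    simp only [validS, Bool.and_eq_true] at h
    exact h.2
  unfold validPS at h1
  rw [Z8.allLT_iff] at h1
  have h2 := h1 l hl
  simp only [Bool.and_eq_true, decide_eq_true_eq] at h2
  exact ⟨h2.1.1.1, h2.1.1.2, h2.1.2, h2.2⟩

end DenseCert

/-! ## Soundness: a valid stacked certificate decides rank [M_δ₁ ; M_δ₂] -/

section sound

variable {K : Type*} [Field K] (ζ : K) {L1 L2 : List PDat} (δ1 δ2 : List (ℚ × LinearCycle 8)) {Ψ : DenseCert}

/-- the stacked row reindexing Fin (45 + 45) ≃ I₂ ⊕ I₂ (first 45 positions ↦ left copy, last 45 ↦ right copy, each through `eRow`). -/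
noncomputable def eRowS : Fin (45 + 45) ≃ (indexSet 8 3 (8 / 2 * 3 - 8 - 2)) ⊕ (indexSet 8 3 (8 / 2 * 3 - 8 - 2)) :=
  finSumFinEquiv.symm.trans (Equiv.sumCongr eRow eRow)

/-- the reindexed stacked matrix S[a, b] = [M_δ₁ ; M_δ₂][eRowS a, eCol b]. -/
noncomputable def NS : Matrix (Fin (45 + 45)) (Fin 120) K :=
  (Matrix.fromRows (ivhsMatrix 8 3 ζ δ1) (ivhsMatrix 8 3 ζ δ2)).submatrix eRowS eCol

variable {δ1 δ2}

/-- positions a < 45 of Fin (45 + 45) go to the left summand … -/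
theorem finSum_symm_of_lt (a : Fin (45 + 45)) (ha : a.1 < 45) : finSumFinEquiv.symm a = Sum.inl (⟨a.1, ha⟩ : Fin 45) := by
  rw [Equiv.symm_apply_eq, finSumFinEquiv_apply_left]
  exact Fin.ext (by rw [Fin.val_castAdd])

/-- … and positions 45 ≤ a to the right summand. -/
theorem finSum_symm_of_ge (a : Fin (45 + 45)) (ha : ¬ a.1 < 45) :
    finSumFinEquiv.symm a = Sum.inr (⟨a.1 - 45, by omega⟩ : Fin 45) := by
  rw [Equiv.symm_apply_eq, finSumFinEquiv_apply_right]
  exact Fin.ext (by rw [Fin.val_natAdd]; dsimp only; omega)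

/-- entries of the reindexed stacked matrix from the stacked entry function (given both class links). -/
theorem NS_apply (hE1 : ∀ i : Fin 10 → ℕ, periodComb 8 3 ζ δ1 i = Z6.eval ζ (entry L1 (ext i)))
    (hE2 : ∀ i : Fin 10 → ℕ, periodComb 8 3 ζ δ2 i = Z6.eval ζ (entry L2 (ext i))) (a : Fin (45 + 45)) (b : Fin 120) :
    NS ζ δ1 δ2 a b = Z6.eval ζ (entryS L1 L2 a.1 b.1) := by
  unfold NS eRowS entryS
  rw [Matrix.submatrix_apply, Equiv.trans_apply]
  by_cases ha : a.1 < 45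
  · rw [finSum_symm_of_lt a ha, Equiv.sumCongr_apply, Sum.map_inl, Matrix.fromRows_apply_inl, if_pos ha]
    exact N_apply ζ hE1 ⟨a.1, ha⟩ b
  · rw [finSum_symm_of_ge a ha, Equiv.sumCongr_apply, Sum.map_inr, Matrix.fromRows_apply_inr, if_neg ha]
    exact N_apply ζ hE2 ⟨a.1 - 45, by omega⟩ b

/-- UPPER BOUND: rank S ≤ r (S = W · S[ρ, ·]). -/
theorem rank_NS_le (h2 : ζ ^ 2 = ζ - 1) (hE1 : ∀ i : Fin 10 → ℕ, periodComb 8 3 ζ δ1 i = Z6.eval ζ (entry L1 (ext i)))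
    (hE2 : ∀ i : Fin 10 → ℕ, periodComb 8 3 ζ δ2 i = Z6.eval ζ (entry L2 (ext i))) (hV : Ψ.validS L1 L2 = true) :
    (NS ζ δ1 δ2).rank ≤ Ψ.r := by
  let ρf : Fin Ψ.r → Fin (45 + 45) := fun l => ⟨Ψ.rhoN l.1, (DenseCert.pivotsS hV l.2).2.2.1⟩
  let Wm : Matrix (Fin (45 + 45)) (Fin Ψ.r) K := fun a l => Z6.eval ζ (Ψ.Wz a.1 l.1)
  have hfac : NS ζ δ1 δ2 = Wm * (NS ζ δ1 δ2).submatrix ρf id := by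
    ext a b
    rw [Matrix.mul_apply, NS_apply ζ hE1 hE2]
    have hu := congrArg (Z6.eval ζ) (DenseCert.US_eq hV a.2 b.2)
    rw [Z6.eval_rsum, Finset.sum_range] at hu
    rw [← hu]
    refine Finset.sum_congr rfl fun l _ => ?_
    rw [Matrix.submatrix_apply, id, NS_apply ζ hE1 hE2]
    unfold DenseCert.utermS
    split_ifs with hz
    · show Z6.eval ζ 0 = Z6.eval ζ (Ψ.Wz a.1 l.1) * Z6.eval ζ (entryS L1 L2 (Ψ.rhoN l.1) b.1)
      rw [eq_zero_of_zIsZero hz, Z6.zero_def, Z6.eval_zero, zero_mul]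
    · rw [Z6.eval_mul ζ h2]
  rw [hfac]
  exact (Matrix.rank_mul_le_right _ _).trans ((Matrix.rank_le_card_height _).trans (by simp))

/-- LOWER BOUND: r ≤ rank S (the pivot minor factors as lower × upper triangular with nonzero diagonals). -/
theorem le_rank_NS [CharZero K] (h2 : ζ ^ 2 = ζ - 1) (hE1 : ∀ i : Fin 10 → ℕ, periodComb 8 3 ζ δ1 i = Z6.eval ζ (entry L1 (ext i)))
    (hE2 : ∀ i : Fin 10 → ℕ, periodComb 8 3 ζ δ2 i = Z6.eval ζ (entry L2 (ext i))) (hV : Ψ.validS L1 L2 = true) :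
    Ψ.r ≤ (NS ζ δ1 δ2).rank := by
  classical
  let ρf : Fin Ψ.r → Fin (45 + 45) := fun l => ⟨Ψ.rhoN l.1, (DenseCert.pivotsS hV l.2).2.2.1⟩
  let γf : Fin Ψ.r → Fin 120 := fun l => ⟨Ψ.gamN l.1, (DenseCert.pivotsS hV l.2).2.2.2⟩
  let Am : Matrix (Fin Ψ.r) (Fin Ψ.r) K := fun h l => Z6.eval ζ (Ψ.Az h.1 l.1)
  let Bm : Matrix (Fin Ψ.r) (Fin Ψ.r) K := fun l g => Z6.eval ζ (Ψ.Bz l.1 g.1)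
  have hS : (NS ζ δ1 δ2).submatrix ρf γf = Am * Bm := by
    ext h g
    rw [Matrix.mul_apply, Matrix.submatrix_apply, NS_apply ζ hE1 hE2]
    have hl := congrArg (Z6.eval ζ) (DenseCert.LS_eq hV h.2 g.2)
    rw [Z6.eval_rsum, Finset.sum_range] at hl
    rw [← hl]
    exact Finset.sum_congr rfl fun l _ => Z6.eval_mul ζ h2 _ _
  have hAt : Am.BlockTriangular OrderDual.toDual := by
    intro h l hlt
    have hlt' : h < l := OrderDual.toDual_lt_toDual.mp hlt
    show Z6.eval ζ (Ψ.Az h.1 l.1) = 0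
    rw [DenseCert.AS_upper_zero hV h.2 l.2 hlt', Z6.zero_def, Z6.eval_zero]
  have hAd : ∀ l : Fin Ψ.r, Am l l ≠ 0 := fun l => Z6.eval_ne_zero_of_posConst ζ (DenseCert.pivotsS hV l.2).1
  have hBt : Bm.BlockTriangular id := by
    intro l g hlt
    have hlt' : g < l := hlt
    show Z6.eval ζ (Ψ.Bz l.1 g.1) = 0
    rw [DenseCert.BS_lower_zero hV l.2 g.2 hlt', Z6.zero_def, Z6.eval_zero]
  have hBd : ∀ l : Fin Ψ.r, Bm l l ≠ 0 := by
    intro l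
    have hw := Z6.eval_ne_zero_of_posConst ζ (DenseCert.pivotsS hV l.2).2.1
    rw [Z6.eval_mul ζ h2] at hw
    exact left_ne_zero_of_mul hw
  have hdet : IsUnit ((NS ζ δ1 δ2).submatrix ρf γf).det := by
    rw [hS, Matrix.det_mul, Matrix.det_of_lowerTriangular _ hAt, Matrix.det_of_upperTriangular hBt]
    exact isUnit_iff_ne_zero.mpr (mul_ne_zero (Finset.prod_ne_zero_iff.mpr fun l _ => hAd l) (Finset.prod_ne_zero_iff.mpr fun l _ => hBd l))
  have hrank : ((NS ζ δ1 δ2).submatrix ρf γf).rank = Ψ.r := by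
    rw [Matrix.rank_of_isUnit _ ((Matrix.isUnit_iff_isUnit_det _).mpr hdet), Fintype.card_fin]
  calc Ψ.r = ((NS ζ δ1 δ2).submatrix ρf γf).rank := hrank.symm
    _ ≤ (NS ζ δ1 δ2).rank := Matrix.rank_submatrix_le _ _ _

end sound

/-- MAIN THEOREM (stacked): class links `periodComb 8 3 ζ δ_i = eval_ζ ∘ entry L_i ∘ ext` (i = 1, 2, every characteristic-0 field with ζ² = ζ − 1)
and a valid stacked certificate for (L₁, L₂) decide rank [M_δ₁ ; M_δ₂] = r over every characteristic-0 field with a primitive 6th root of unity. -/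
theorem stackRank_of_cert (L1 L2 : List PDat) (δ1 δ2 : List (ℚ × LinearCycle 8))
    (hE1 : ∀ (K : Type) [Field K] (ζ : K), ζ ^ 2 = ζ - 1 → ∀ i : Fin 10 → ℕ, periodComb 8 3 ζ δ1 i = Z6.eval ζ (entry L1 (ext i)))
    (hE2 : ∀ (K : Type) [Field K] (ζ : K), ζ ^ 2 = ζ - 1 → ∀ i : Fin 10 → ℕ, periodComb 8 3 ζ δ2 i = Z6.eval ζ (entry L2 (ext i)))
    (Ψ : DenseCert) (hV : Ψ.validS L1 L2 = true) :
    ∀ (K : Type) [Field K] [CharZero K] (ζ : K), IsPrimitiveRoot ζ (2 * 3) →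
      (Matrix.fromRows (ivhsMatrix 8 3 ζ δ1) (ivhsMatrix 8 3 ζ δ2)).rank = Ψ.r := by
  intro K _ _ ζ hζ
  have h2 : ζ ^ 2 = ζ - 1 := (primRoot6_facts ζ hζ).2.2
  rw [← Matrix.rank_submatrix (Matrix.fromRows (ivhsMatrix 8 3 ζ δ1) (ivhsMatrix 8 3 ζ δ2)) eRowS eCol]
  exact le_antisymm (rank_NS_le ζ h2 (hE1 K ζ h2) (hE2 K ζ h2) hV) (le_rank_NS ζ h2 (hE1 K ζ h2) (hE2 K ζ h2) hV)

/-! ## The single planes of the (8,3,2) rows as one-element class lists (matchings / twists from `HodgeLocusCensusTwoBlockCerts`) -/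

/-- [P0]: the standard 4-plane (matching id, no twists). -/
def p0L : List PDat := [⟨1, blId, alZero⟩]
/-- [Ptwo]: the two-block 4-plane (matching (3 4)(7 8), sign +1, no twists). -/
def ptwoL : List PDat := [⟨1, blTwo, alZero⟩]
/-- [P̌₂] = `standardPc 8 2 1`: the standard twisted 4-plane (matching id, twist 1 on the last two pairs), P0 ∩ P̌₂ = ℙ². -/
def pstdL : List PDat := [⟨1, blId, alStd⟩]

end Summit.HodgeConjecture.HodgeConjecture.HodgeLocus.Census.DenseCert8
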